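import Literature.Topology.PlanarFoliations.NoInnerSpiral
import HarnessLib

/-!
# Leaves inside a terminal zone: separatrices, and compact null leaves near the trace

Topic: Topology / PlanarFoliations, sequel to `NoInnerSpiral.lean` (no open leaf inside a terminal
zone accumulates on a point of the domain on its trace). With the zone hypotheses at **every** point
of the domain on the trace (`hlocAll`):

* `limitSets_of_inner_leaf` (**proved**): **every open leaf inside the zone is a separatrix at
  both ends** — its ω- and α-limit sets are single punctures: a limit set not made of punctures
  contains a point of the domain, whose leaf is compact (essential by `Regions`, yet image-null by
  `hcpt` unless it meets the trace, where the open leaf would accumulate) or open (hugging gives an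
  essential polygon, on the trace by `hpoly`, accumulated by the open leaf);
* `eventually_compact_imageNull` (**proved**): **along a path of the domain starting on the trace
  and running inside the zone, the leaves are eventually compact and image-null** towards the
  trace point — an open leaf there is a level leaf of a puncture (finitely many), and a level leaf
  met arbitrarily close to the trace point would contain it (then lie on the trace) or accumulate
  on it.

These are the inputs of the vanishing-cycle constructions (`VanishingBand`, `WalkVanishing`) at a
terminal essential pattern [CamachoLinsNeto1985, Ch. VII §2, p. 137].

## References

* C. Camacho, A. Lins Neto, *Geometric Theory of Foliations*, Birkhäuser (1985), Ch. VII §2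
  [CamachoLinsNeto1985].
-/

noncomputable section

open Set Filter Function Metric
open _root_.Topology
open Literature.Topology.FourManifolds Literature.Topology.FourManifolds.Foliation Literature.Topology.PlaneTopology

namespace Literature.Topology.PlanarFoliations

variable {X : Type*} [TopologicalSpace X] [T2Space X] [SecondCountableTopology X] [Nonempty X] {F : Foliation ℝ X} {ι : X → ℂ}
variable {B : Type*} [NormedAddCommGroup B] [NormedSpace ℝ B] [LocallyConnectedSpace B] {M : Type*} [TopologicalSpace M]
  {T : Foliation B M} {g : ℂ → M}

namespace StarData

variable (D : StarData F ι T g) (hbi : IsBiOriented F) (hι : IsOpenEmbedding ι) (ho : F.IsTransverselyOriented)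
  {C : Set ℂ} (hC : IsCompact C) (hCΩ : C ⊆ D.Ω)
  {γ : ℝ → ℂ} (hJ : IsJordanLoop γ) (hγC : IsJordanLoop.fill γ ⊆ C)
  (hsat : ∀ x', ι x' ∈ range γ → ∀ x'' ∈ F.leaf x', ι x'' ∈ range γ)
  (hcpt : ∀ y', IsCompact (F.leaf y') → ι '' F.leaf y' ⊆ IsJordanLoop.fill γ →
    Disjoint (ι '' F.leaf y') (range γ) → ImageNull D.foliated y')
  (hpoly : ∀ Q : D.PolyCycle hbi C, (∀ i (q : F.Leaf (Q.sx i)), ι (Leaf.pt q) ∈ IsJordanLoop.fill γ) →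
    ¬ (Q.leafLoop hι hC).Homotopic (Path.refl _) → ∀ i (q : F.Leaf (Q.sx i)), ι (Leaf.pt q) ∈ range γ)
  (hlocAll : ∀ xk, ι xk ∈ range γ → ∃ e ∈ F.atlas, xk ∈ e.source ∧ ∃ ε > 0, ∀ x', ι x' ∈ range γ → x' ∈ e.source →
    |(e x').1 - (e xk).1| < ε → |(e x').2 - (e xk).2| < ε → (e x').2 = (e xk).2)

/-! ## Inner leaves -/

include hJ hsat in
omit [T2Space X] [SecondCountableTopology X] [Nonempty X] in
/-- **A leaf with a point inside the zone lies inside the zone.** [folklore] -/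
theorem image_leaf_subset_inside (hιc : Continuous ι) {y : X} (hy : ι y ∈ IsJordanLoop.inside γ) :
    ι '' F.leaf y ⊆ IsJordanLoop.inside γ := by
  have hsub : ι '' F.leaf y ⊆ (range γ)ᶜ := by
    rintro _ ⟨w, hw, rfl⟩ hwr
    exact hy.1 (hsat w hwr y (mem_leaf_comm.1 hw))
  have h := (isPreconnected_image_leaf hιc y).subset_connectedComponentIn ⟨y, F.mem_leaf_self y, rfl⟩ hsub
  rwa [← hJ.inside_eq_connectedComponentIn hy] at h

include hJ in
omit [T2Space X] [SecondCountableTopology X] [Nonempty X] in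
/-- The closure of the image of an inner leaf lies in the fill. [folklore] -/
theorem closure_image_leaf_subset_fill {y : X} (hyU : ι '' F.leaf y ⊆ IsJordanLoop.inside γ) :
    closure (ι '' F.leaf y) ⊆ IsJordanLoop.fill γ := by
  rw [IsJordanLoop.fill, union_comm, ← hJ.closure_inside_eq]; exact closure_mono hyU

include ho hC hCΩ hJ hγC hsat hcpt hpoly hlocAll in
/-- **Every open leaf inside a terminal zone is a separatrix at both ends.**
[cite: CamachoLinsNeto1985, Ch. VII §2] -/
theorem limitSets_of_inner_leaf {y : X} [NoncompactSpace (F.Leaf y)] (hyU : ι '' F.leaf y ⊆ IsJordanLoop.inside γ) :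
    (∃ v ∈ D.P, omegaSet hbi ι y = {v} ∧ ∃ s ∈ D.levelLeaves v, y ∈ F.leaf s) ∧
      (∃ v ∈ D.P, alphaSet hbi ι y = {v} ∧ ∃ s ∈ D.levelLeaves v, y ∈ F.leaf s) := by
  have hιc := hι.continuous
  have hfill : closure (ι '' F.leaf y) ⊆ IsJordanLoop.fill γ := closure_image_leaf_subset_fill hJ hyU
  have hmem : ∀ q : F.Leaf y, ι (Leaf.pt q) ∈ C := fun q ↦ hγC (hfill (subset_closure ⟨Leaf.pt q, q.2, rfl⟩))
  have hLcl : omegaSet hbi ι y ∪ alphaSet hbi ι y ⊆ closure (ι '' F.leaf y) := limitSets_subset_closure hι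
  -- the zone theorems at a point of the domain on the trace accumulated by the leaf
  have hzone : ∀ xk, ι xk ∈ range γ → ι xk ∉ omegaSet hbi ι y ∪ alphaSet hbi ι y := by
    intro xk hxk h
    obtain ⟨e, he, hxke, hloc⟩ := hlocAll xk hxk
    rcases h with h | h
    · exact D.not_mem_omegaSet_of_zone hbi hι ho hC hCΩ hJ hγC hsat hcpt hpoly hyU hxk he hxke hloc h
    · exact D.not_mem_alphaSet_of_zone hbi hι ho hC hCΩ hJ hγC hsat hcpt hpoly hyU hxk he hxke hloc h
  -- a compact leaf through a limit point is impossible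
  have hnoK : ∀ y', ι y' ∈ omegaSet hbi ι y ∪ alphaSet hbi ι y → ¬ IsCompact (F.leaf y') := by
    intro y' hy' hK'
    have hsatL : ι '' F.leaf y' ⊆ omegaSet hbi ι y ∪ alphaSet hbi ι y := by
      rintro _ ⟨w, hw, rfl⟩; exact mem_limitSets_of_mem_leaf hι hy' hw
    by_cases hdis : Disjoint (ι '' F.leaf y') (range γ)
    · have hnull := hcpt y' hK' (hsatL.trans (hLcl.trans hfill)) hdis
      rcases hy' with h | h
      · exact not_imageNull_of_mem_omegaSet hbi hι ho D.foliated h hK' hnull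
      · exact not_imageNull_of_mem_alphaSet hbi hι ho D.foliated h hK' hnull
    · obtain ⟨z, hzK, hzr⟩ := not_disjoint_iff.1 hdis
      obtain ⟨xk, hxk, rfl⟩ := hzK
      exact hzone xk hzr (hsatL ⟨xk, hxk, rfl⟩)
  -- a line leaf through a limit point is impossible: hugging
  have hnoS : ∀ y', ι y' ∈ omegaSet hbi ι y ∪ alphaSet hbi ι y → IsCompact (F.leaf y') := by
    intro y' hy'
    by_contra hnc
    have hy'G : ι y' ∈ limGraph hbi ι y := ⟨hy', y', rfl, hnc⟩
    obtain ⟨Q, hQ, hQess⟩ := D.exists_polyCycle_of_mem_limGraph hbi hι ho hC hCΩ hmem hy'G (Pinv := fun _ ↦ True) trivial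
      (fun _ _ _ _ _ _ _ _ _ _ _ ↦ trivial)
    haveI := Q.neZero
    have hQfill : ∀ i (q : F.Leaf (Q.sx i)), ι (Leaf.pt q) ∈ IsJordanLoop.fill γ := fun i q ↦
      hfill (hLcl (mem_limitSets_of_mem_leaf hι (limGraph_subset (hQ i).1) q.2))
    have hon := hpoly Q hQfill hQess (0 : Fin Q.m) (Leaf.base F (Q.sx 0))
    exact hzone (Q.sx 0) hon (limGraph_subset (hQ 0).1)
  -- so the limit sets contain no point of the domain: they are punctures
  have hP : omegaSet hbi ι y ∪ alphaSet hbi ι y ⊆ D.P := by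
    intro z hz
    have hzC : z ∈ C := by
      rcases hz with h | h
      · exact omegaSet_subset_of_forall_mem hC.isClosed hmem h
      · exact alphaSet_subset_of_forall_mem hC.isClosed hmem h
    by_contra hzP
    have hzr : z ∈ range ι := by rw [D.range_eq]; exact ⟨hCΩ hzC, hzP⟩
    obtain ⟨y', rfl⟩ := hzr
    exact hnoK y' hz (hnoS y' hz)
  exact ⟨D.toPunctureData.exists_omegaSet_eq_singleton hι hC hmem (subset_union_left.trans hP),
    D.toPunctureData.exists_alphaSet_eq_singleton hι hC hmem (subset_union_right.trans hP)⟩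

/-! ## Near the trace, inner leaves are compact and image-null -/

include ho hC hCΩ hJ hγC hsat hcpt hpoly hlocAll in
/-- **Along a path of the domain from a trace point into the zone, the leaves are eventually compact
and image-null**: for `sg` continuous at `0` within the parameter set `A` with `ι (sg 0)` on the trace
and `ι (sg a)` inside `γ` for `a ∈ A`, eventually along `𝓝[A] 0` the leaf of `sg a` is compact and
image-null. [cite: CamachoLinsNeto1985, Ch. VII §2] -/
theorem eventually_compact_imageNull {sg : ℝ → X} {A : Set ℝ} (hsgc : ContinuousWithinAt sg A 0)
    (hsg0 : ι (sg 0) ∈ range γ) (hsgA : ∀ a ∈ A, ι (sg a) ∈ IsJordanLoop.inside γ) :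
    ∀ᶠ a in 𝓝[A] 0, IsCompact (F.leaf (sg a)) ∧ ImageNull D.foliated (sg a) := by
  have hιc := hι.continuous
  -- the finitely many level leaves are eventually avoided
  set LEV : Set X := ⋃ v ∈ D.P, D.levelLeaves v with hLEV
  have hLEVf : LEV.Finite := D.P_finite.biUnion fun v _ ↦ D.finite_levelLeaves v
  have havoid : ∀ sl ∈ LEV, ∀ᶠ a in 𝓝[A] 0, sg a ∉ F.leaf sl := by
    intro sl _
    by_contra hfr
    rw [not_eventually] at hfr
    simp only [not_not] at hfr
    -- `ι (sg 0)` is in the closure of the image of the leaf of `sl`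
    have hcl : ι (sg 0) ∈ closure (ι '' F.leaf sl) := by
      have ht : Tendsto (fun a ↦ ι (sg a)) (𝓝[A] 0) (𝓝 (ι (sg 0))) := (hιc.tendsto _).comp hsgc
      exact mem_closure_iff_frequently.2 ((ht.frequently (hfr.mono fun a ha ↦ show ι (sg a) ∈ ι '' F.leaf sl from ⟨sg a, ha, rfl⟩)).mono
        fun _ h ↦ h)
    -- the leaf of `sl` has a point inside, so lies inside
    obtain ⟨a, haL, haA⟩ := (hfr.and_eventually self_mem_nhdsWithin).exists
    have hslU : ι '' F.leaf sl ⊆ IsJordanLoop.inside γ := by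
      rw [← leaf_eq_of_mem haL]; exact image_leaf_subset_inside hJ hsat hιc (hsgA a haA)
    have h0 : sg 0 ∉ F.leaf sl := fun h ↦ (hslU ⟨sg 0, h, rfl⟩).1 hsg0
    by_cases hK : IsCompact (F.leaf sl)
    · rw [(hK.image hιc).isClosed.closure_eq] at hcl
      obtain ⟨w, hw, hwe⟩ := hcl
      exact h0 (hι.injective hwe ▸ hw)
    · haveI := noncompactSpace_leaf_of_not_isCompact' hK
      rw [closure_image_leaf (hbi := hbi) hι] at hcl
      rcases hcl with (⟨w, hw, hwe⟩ | h) | h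
      · exact h0 (hι.injective hwe ▸ hw)
      · obtain ⟨e, he, hxke, hloc⟩ := hlocAll (sg 0) hsg0
        exact D.not_mem_omegaSet_of_zone hbi hι ho hC hCΩ hJ hγC hsat hcpt hpoly hslU hsg0 he hxke hloc h
      · obtain ⟨e, he, hxke, hloc⟩ := hlocAll (sg 0) hsg0
        exact D.not_mem_alphaSet_of_zone hbi hι ho hC hCΩ hJ hγC hsat hcpt hpoly hslU hsg0 he hxke hloc h
  have hall : ∀ᶠ a in 𝓝[A] 0, ∀ sl ∈ LEV, sg a ∉ F.leaf sl := hLEVf.eventually_all.2 havoid |>.mono fun a ha sl hsl ↦ ha sl hsl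
  filter_upwards [hall, self_mem_nhdsWithin] with a ha haA
  have hU : ι '' F.leaf (sg a) ⊆ IsJordanLoop.inside γ := image_leaf_subset_inside hJ hsat hιc (hsgA a haA)
  -- an open leaf there would be a level leaf
  have hK : IsCompact (F.leaf (sg a)) := by
    by_contra hnc
    haveI := noncompactSpace_leaf_of_not_isCompact' hnc
    obtain ⟨⟨v, hv, -, sl, hsl, hmem⟩, -⟩ := D.limitSets_of_inner_leaf hbi hι ho hC hCΩ hJ hγC hsat hcpt hpoly hlocAll hU
    exact ha sl (mem_iUnion₂.2 ⟨v, hv, hsl⟩) hmem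
  refine ⟨hK, hcpt _ hK ?_ (disjoint_left.2 fun z hz hzr ↦ (hU hz).1 hzr)⟩
  exact (subset_closure.trans (closure_image_leaf_subset_fill hJ hU))

end StarData

end Literature.Topology.PlanarFoliations
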